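import Mathlib
import HarnessLib
import Summits.HubbardSuperconductivity.HubbardSuperconductivity.Theorems.KLProgrammeKLRegimeBetaSplitEdgeFZ

/-!
# Route `KLProgramme` — crux K3 gen 8, CHILD 1 (`KLRegimeBetaSplitV17F2`, BetaSplitP): the child-1 closer with a THIRD budget unit `zG(G)·Klam⁴·U²` —
# `pairArrayAtV17F_of_edgeClauses_explicitG`, **`betaSplitP_of_edgeClausesFZG`** (rider of located #27's cure «Z-slot», G-LEVEL coefficient shape; KL STATUS (R675)/(R698))

Cell gate-hubbard-kl, seat hubbard-kl-k3c1-p1 g28 (child-1 lineage; technique «composed-map remainder propagation»).  My DESIGN-CONSTRAINT line (KL STATUS 2026-08-30 12:39Z,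
booked (R698)): child 1's REGISTERED tolerance token is `(P.C_W + klLegKappa·Q.CR·P.Klam³)·U²` and the quantifier order is ENGINE `∃G ∀P ∃Q ∀R` vs child 1 `∀G ∃P ∀Q … ∃c₀ … ∀R ∃U₀`,
so an n-flat in-class slot the ENGINE must size is absorbable WITHOUT a registry change of the token in exactly two shapes: (a) coefficient ∝ `Q.CR` — absorbed in the `klLegKappa`
slack (landed: `…BetaSplitEdgeFZ` / `…BetaSplitV17F2Z`, `betaSplitP_klPredsV17F2_zslot`); (b) a `G`-LEVEL coefficient (a `GeoConsts` datum, fixed before child 1 picks `P`) —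
absorbed in `C_W`.  THIS FILE builds (b): row 0′'s explicit lemma and the generic closer with a third unit `zG·Klam⁴·U²` threaded through the three places that price the extra
family (per-scale `Xsup`, window `Xtot`, the no-onset bracket) and into `C_W`; all other numerals, constants and the per-scale step byte-identical.  The slot-level instance
(`betaSplitP_of_clausesV17F2ZG`, `betaSplitP_klPredsV17F2_zslotG`) is the next file.  Everything is proved; no definitions; nothing about the model is asserted; no registered text
is edited; nothing asserts superconductivity.
-/

noncomputable section

namespace Summit.HubbardSuperconductivity.HubbardSuperconductivity.Theorems.KLRegimeSplit

set_option linter.dupNamespace false -- summit = problem name (single-conjunct summit), D-0017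

open Real Finset Literature.MathematicalPhysics.QuantumLattice Literature.Probability.LatticeModels
open Summit.HubbardSuperconductivity.HubbardSuperconductivity.Theorems.KLProgrammeLegKernels
open Summit.HubbardSuperconductivity.HubbardSuperconductivity.Theorems.CooperChannelRiccatiFlow
open Summit.HubbardSuperconductivity.HubbardSuperconductivity.Theorems.DispersionFlow

section Model

variable (L M : ℕ) [NeZero L] [NeZero M]

variable {G : GeoConsts} {P : SplitConsts} {Qc : EngConsts}

set_option maxHeartbeats 400000 in -- polynomial bookkeeping (`nlinarith` on ~10 atoms); pre-empted per the cell's heartbeat rule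
/-- **Row 0′ with the constants chosen, THREE budget units** (twin of `pairArrayAtV17F_of_edgeClauses_explicit`): the extra majorant `X` may also spend a
`G`-LEVEL flat unit `zG·Klam⁴·U²` (`0 ≤ zG`): per-scale `≤ sG·CF(Klam U)² + sQ·CR·Klam³U² + sF·zG·Klam⁴U²`, scale sums `≤ tG·(…) + tQ·(…) + tF·zG·Klam⁴U²`; the no-onset
line's bracket gains `(tF+sF)·zG·Klam⁴` and `C_W` must dominate `… + (12(tF+sF)+tF)·zG·Klam⁴`.  Everything else verbatim (`flowPairArray_envelope_edge` is generic in `Xtot/Xsup`). -/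
theorem pairArrayAtV17F_of_edgeClauses_explicitG (hG : G.WF) (hP : P.WF) (hQc : Qc.WF) {β U μ : ℝ} (hU : 0 ≤ U) {n : ℕ} {sG sQ tG tQ sF tF zG : ℝ} (hsG : 0 ≤ sG) (hsQ : 0 ≤ sQ)
    (htG : 0 ≤ tG) (htQ : 0 ≤ tQ) (hsF : 0 ≤ sF) (htF : 0 ≤ tF) (hzG : 0 ≤ zG)
    (hκ : 12 * (tQ + sQ) + tQ ≤ klLegKappa)
    (X : ℕ → TorusSite 2 L → TorusSite 2 L → TorusSite 2 L → ℝ) (hX0 : ∀ j Qm k k', 0 ≤ X j Qm k k')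
    (hXsup : ∀ j Qm k k', X j Qm k k' ≤ sG * (G.CF * (P.Klam * U) ^ 2) + sQ * (Qc.CR * P.Klam ^ 3 * U ^ 2) + sF * (zG * P.Klam ^ 4 * U ^ 2))
    (hXsum : ∀ (t : ℕ) (Qm k k' : TorusSite 2 L),
      ∑ j ∈ Ioc t n, X j Qm k k' ≤ tG * (G.CF * (P.Klam * U) ^ 2) + tQ * (Qc.CR * P.Klam ^ 3 * U ^ 2) + tF * (zG * P.Klam ^ 4 * U ^ 2))
    (hXtot : ∀ Qm k k' : TorusSite 2 L,
      X 0 Qm k k' + ∑ i ∈ range n, X (i + 1) Qm k k' ≤ tG * (G.CF * (P.Klam * U) ^ 2) + tQ * (Qc.CR * P.Klam ^ 3 * U ^ 2) + tF * (zG * P.Klam ^ 4 * U ^ 2))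
    (δ : ℕ → TorusSite 2 L → ℝ)
    (hneg : ∀ Qm : TorusSite 2 L, ∀ t ≤ n, IsPairClassAt L Qm t → 16 * U * ∑ i ∈ range t, δ (i + 1) Qm ≤ 1)
    (h0 : ∀ Qm : TorusSite 2 L, ∀ k ∈ klBall L μ 0, ∀ k' ∈ klBall L μ 0,
      ‖klPairAmplitude L M β U μ (klFlowFrameU L M β U μ 0) 0 Qm k k' - (U : ℂ)‖ ≤ initDevBar G U + X 0 Qm k k')
    (hsteps : ∀ j, 1 ≤ j → j ≤ n → ∀ Qm : TorusSite 2 L, IsPairClassAt L Qm j →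
      ∃ w : TorusSite 2 L → ℝ, (∑ p, |w p| ≤ G.bhi) ∧ (∑ p, (|w p| - w p) ≤ δ j Qm) ∧
        ∃ N : Matrix (TorusSite 2 L) (TorusSite 2 L) ℂ,
          (1 + Matrix.diagonal (fun p => (w p : ℂ)) * klPairArrayF L M β U μ (j - 1) Qm) * N = 1 ∧
          ∀ k ∈ klBall L μ 0, ∀ k' ∈ klBall L μ 0,
            ‖klPairAmplitude L M β U μ (klFlowFrameU L M β U μ j) j Qm k k' - (klPairArrayF L M β U μ (j - 1) Qm * N) k k'‖ ≤
              drivePBar G P U (j - 1) + eremBar G P Qc U β L (j - 1) + X j Qm k k')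
    (hincr : ∀ j, 1 ≤ j → j ≤ n → ∀ Qm : TorusSite 2 L, ∀ k ∈ klBall L μ 0, ∀ k' ∈ klBall L μ 0,
      ‖klPairAmplitude L M β U μ (klFlowFrameU L M β U μ j) j Qm k k' - klPairAmplitude L M β U μ (klFlowFrameU L M β U μ (j - 1)) (j - 1) Qm k k'‖ ≤
        gainBar G P U j (klTorusNorm L Qm) (klTorusNorm L (k - k')) (klTorusNorm L (k + k' - Qm)) +
          eremBar G P Qc U β L (j - 1) + X j Qm k k')
    (hUCR : 2 * Qc.CR * P.Klam ^ 3 * |U| ≤ 1) (hL : 17 * ∑ j ∈ range n, Qc.CL β j / L ≤ U ^ 2)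
    (hsmall : 8 * 42 * (((∑ χ : D4Irrep, (G.abot χ + G.atop χ) + 1) +
        2 * (G.aplus * P.Klam ^ 2 * G.Z + G.cloc * P.Klam ^ 2 * (1 - (4 : ℝ) ^ (-G.θ))⁻¹ + 1) + 1 +
          (tG + sG) * (G.CF * P.Klam ^ 2) + (tQ + sQ) * (Qc.CR * P.Klam ^ 3) + (tF + sF) * (zG * P.Klam ^ 4)) * U ^ 2) * (G.bhi * n) ≤ 1)
    (hCW : 12 * (∑ χ : D4Irrep, (G.abot χ + G.atop χ) + 1) +
        25 * (G.aplus * P.Klam ^ 2 * G.Z + G.cloc * P.Klam ^ 2 * (1 - (4 : ℝ) ^ (-G.θ))⁻¹ + 1) + 2 +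
          (12 * (tG + sG) + 3 + tG) * (G.CF * P.Klam ^ 2) + (12 * (tF + sF) + tF) * (zG * P.Klam ^ 4) ≤ P.C_W) :
    PairArrayAtV17F L M P Qc β U μ n := by
  have hdrive := drivePBar_sum_le (P := P) hG U n
  have herem := eremBar_sum_le hG hP hQc U β L n
  have hU2 : 0 ≤ U ^ 2 := sq_nonneg U
  have hCL0 : 0 ≤ ∑ j ∈ range n, Qc.CL β j / L := sum_nonneg fun j _ => div_nonneg (hQc.2.2.2.2.2.2.2 β j) (Nat.cast_nonneg L)
  have hθ : 0 < G.θ := hG.2.2.2.2.2.1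
  have hg : 0 ≤ (1 - (4 : ℝ) ^ (-G.θ))⁻¹ :=
    inv_nonneg.2 (by have := Real.rpow_lt_one_of_one_lt_of_neg (x := (4 : ℝ)) (by norm_num) (by linarith : -G.θ < 0); linarith)
  have hK0 : 0 ≤ P.Klam := zero_le_one.trans hP.1
  have hcloc : 0 ≤ G.cloc := hG.2.2.2.2.1
  have haplus : 0 ≤ G.aplus := hG.2.2.2.2.2.2.2.2.2.2.1
  have hCF : 0 ≤ G.CF := hG.2.2.2.2.2.2.2.2.2.2.2.2.2.1
  have hCR : 0 ≤ Qc.CR := hQc.2.1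
  have hbhi : 0 ≤ G.bhi := hG.2.2.1.trans hG.2.2.2.1
  have hab : 0 ≤ ∑ χ : D4Irrep, (G.abot χ + G.atop χ) := sum_nonneg fun χ _ => add_nonneg (hG.2.1 χ) (hG.1 χ)
  have hZ : 0 ≤ G.Z := le_trans (sum_nonneg fun j _ => hG.2.2.2.2.2.2.2.2.1 j) (hG.2.2.2.2.2.2.2.2.2.1 0)
  -- the two quadratic units `g2 = CF·(Klam U)²`, `q3 = CR·Klam³·U²` and the product facts `linarith` needs
  have hg20 : 0 ≤ G.CF * (P.Klam * U) ^ 2 := by positivity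
  have hq30 : 0 ≤ Qc.CR * P.Klam ^ 3 * U ^ 2 := by positivity
  have hsq : G.CF * (P.Klam * U) ^ 2 = (G.CF * P.Klam ^ 2) * U ^ 2 := by ring
  have hf40 : 0 ≤ zG * P.Klam ^ 4 * U ^ 2 := by positivity
  have hfq : zG * P.Klam ^ 4 * U ^ 2 = (zG * P.Klam ^ 4) * U ^ 2 := by ring
  have hCRU : 2 * Qc.CR * P.Klam ^ 3 * |U| * U ^ 2 ≤ U ^ 2 := by nlinarith
  have hS : ∑ j ∈ range n, (drivePBar G P U j + eremBar G P Qc U β L j) ≤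
      (G.aplus * P.Klam ^ 2 * G.Z + G.cloc * P.Klam ^ 2 * (1 - (4 : ℝ) ^ (-G.θ))⁻¹) * U ^ 2 +
        2 * Qc.CR * P.Klam ^ 3 * |U| * U ^ 2 + ∑ j ∈ range n, Qc.CL β j / L := by
    rw [sum_add_distrib]; nlinarith [hdrive, herem]
  have hS0 : 0 ≤ ∑ j ∈ range n, (drivePBar G P U j + eremBar G P Qc U β L j) :=
    sum_nonneg fun j _ => add_nonneg (drivePBar_nonneg' hG U j) (eremBar_nonneg' hG hP hQc U β L j)
  have hinit : initDevBar G U = (∑ χ : D4Irrep, (G.abot χ + G.atop χ) + 1) * U ^ 2 := rfl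
  have hn0 : (0 : ℝ) ≤ n := Nat.cast_nonneg n
  have hSe0 : 0 ≤ ∑ i ∈ range n, eremBar G P Qc U β L i := sum_nonneg fun i _ => eremBar_nonneg' hG hP hQc U β L i
  have haKZU : 0 ≤ G.aplus * P.Klam ^ 2 * G.Z * U ^ 2 := by positivity
  have hcKgU : 0 ≤ G.cloc * P.Klam ^ 2 * (1 - (4 : ℝ) ^ (-G.θ))⁻¹ * U ^ 2 := by positivity
  have hXtot0 : 0 ≤ tG * (G.CF * (P.Klam * U) ^ 2) + tQ * (Qc.CR * P.Klam ^ 3 * U ^ 2) + tF * (zG * P.Klam ^ 4 * U ^ 2) := by positivity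
  have hXsup0 : 0 ≤ sG * (G.CF * (P.Klam * U) ^ 2) + sQ * (Qc.CR * P.Klam ^ 3 * U ^ 2) + sF * (zG * P.Klam ^ 4 * U ^ 2) := by positivity
  -- the no-onset line
  have hsm : 8 * 42 * ((initDevBar G U + ∑ j ∈ range n, (drivePBar G P U j + eremBar G P Qc U β L j) +
          (tG * (G.CF * (P.Klam * U) ^ 2) + tQ * (Qc.CR * P.Klam ^ 3 * U ^ 2) + tF * (zG * P.Klam ^ 4 * U ^ 2))) +
        (∑ j ∈ range n, (drivePBar G P U j + eremBar G P Qc U β L j) +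
          (sG * (G.CF * (P.Klam * U) ^ 2) + sQ * (Qc.CR * P.Klam ^ 3 * U ^ 2) + sF * (zG * P.Klam ^ 4 * U ^ 2)))) * (G.bhi * n) ≤ 1 := by
    refine le_trans ?_ hsmall
    have hmain : (initDevBar G U + ∑ j ∈ range n, (drivePBar G P U j + eremBar G P Qc U β L j) +
          (tG * (G.CF * (P.Klam * U) ^ 2) + tQ * (Qc.CR * P.Klam ^ 3 * U ^ 2) + tF * (zG * P.Klam ^ 4 * U ^ 2))) +
        (∑ j ∈ range n, (drivePBar G P U j + eremBar G P Qc U β L j) +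
          (sG * (G.CF * (P.Klam * U) ^ 2) + sQ * (Qc.CR * P.Klam ^ 3 * U ^ 2) + sF * (zG * P.Klam ^ 4 * U ^ 2))) ≤
        ((∑ χ : D4Irrep, (G.abot χ + G.atop χ) + 1) +
          2 * (G.aplus * P.Klam ^ 2 * G.Z + G.cloc * P.Klam ^ 2 * (1 - (4 : ℝ) ^ (-G.θ))⁻¹ + 1) + 1 +
            (tG + sG) * (G.CF * P.Klam ^ 2) + (tQ + sQ) * (Qc.CR * P.Klam ^ 3) + (tF + sF) * (zG * P.Klam ^ 4)) * U ^ 2 := by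
      rw [hinit]
      linarith [hS, hCRU, hL, hCL0, hsq, hU2, hfq]
    have h0' : 0 ≤ (initDevBar G U + ∑ j ∈ range n, (drivePBar G P U j + eremBar G P Qc U β L j) +
          (tG * (G.CF * (P.Klam * U) ^ 2) + tQ * (Qc.CR * P.Klam ^ 3 * U ^ 2) + tF * (zG * P.Klam ^ 4 * U ^ 2))) +
        (∑ j ∈ range n, (drivePBar G P U j + eremBar G P Qc U β L j) +
          (sG * (G.CF * (P.Klam * U) ^ 2) + sQ * (Qc.CR * P.Klam ^ 3 * U ^ 2) + sF * (zG * P.Klam ^ 4 * U ^ 2))) := by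
      rw [hinit]; positivity
    exact mul_le_mul_of_nonneg_right (mul_le_mul_of_nonneg_left hmain (by norm_num)) (mul_nonneg hbhi hn0)
  -- the tolerance line: `24·S + Σē ≤ (25(aKZ + cKg) + 27)·U²`, the `g2`/`q3` numerals, `C_W`, `klLegKappa`
  have herem' : ∑ i ∈ range n, eremBar G P Qc U β L i ≤
      G.cloc * P.Klam ^ 2 * (1 - (4 : ℝ) ^ (-G.θ))⁻¹ * U ^ 2 + 2 * Qc.CR * P.Klam ^ 3 * |U| * U ^ 2 +
        ∑ j ∈ range n, Qc.CL β j / L := by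
    have := herem; linarith
  have hT1 : 24 * ∑ j ∈ range n, (drivePBar G P U j + eremBar G P Qc U β L j) + ∑ i ∈ range n, eremBar G P Qc U β L i ≤
      25 * (G.aplus * P.Klam ^ 2 * G.Z * U ^ 2 + G.cloc * P.Klam ^ 2 * (1 - (4 : ℝ) ^ (-G.θ))⁻¹ * U ^ 2) + 27 * U ^ 2 := by
    linarith [hS, herem', hCRU, hL, hCL0, haKZU]
  have hCWU := mul_le_mul_of_nonneg_right hCW hU2
  have hκq : (12 * (tQ + sQ) + tQ) * (Qc.CR * P.Klam ^ 3 * U ^ 2) ≤ klLegKappa * (Qc.CR * P.Klam ^ 3 * U ^ 2) :=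
    mul_le_mul_of_nonneg_right hκ hq30
  intro Qm
  obtain ⟨u, hu0, huU, hu⟩ := flowPairArray_envelope_edge L M hG hP hQc hU X
    (Xtot := tG * (G.CF * (P.Klam * U) ^ 2) + tQ * (Qc.CR * P.Klam ^ 3 * U ^ 2) + tF * (zG * P.Klam ^ 4 * U ^ 2))
    (Xsup := sG * (G.CF * (P.Klam * U) ^ 2) + sQ * (Qc.CR * P.Klam ^ 3 * U ^ 2) + sF * (zG * P.Klam ^ 4 * U ^ 2)) hX0 hXtot0 hXsup0
    hXsup hXsum hXtot δ hneg h0 hsteps hincr Qm hsm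
  refine ⟨u, hu0, huU.trans (by rw [abs_of_nonneg hU]; linarith), fun k hk k' hk' => (hu k hk k' hk').trans ?_⟩
  rw [hinit]
  linarith [hT1, hCWU, hκq, hq30, hg20, hS0, hSe0, hsq, hf40, hfq]

end Model

/-! ## The child-1 theorem in scheme F, KL-regime-aware extra family, three budget units -/

/-- **Child 1 for every bundle and window in scheme F-II, KL-regime-aware extra family WITH A `G`-LEVEL FLAT UNIT** (twin of `betaSplitP_of_edgeClausesFZ`):
as there, plus numerals `sF tF ≥ 0` and a caller function `zG : GeoConsts → ℝ` (`0 ≤ zG G` under `G.WF`) pricing a third budget unit `zG G·Klam⁴·U²` in the extra family's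
per-scale and scale-sum bounds; child 1 absorbs it in `C_W := … + (12(tF+sF)+tF)·zG G·Klam⁴` and in the no-onset constant (`Crow += (tF+sF)·zG G·Klam⁴`) — legitimate because
`BetaSplitP` lets child 1 choose `P` AFTER `G`.  Use: an n-flat in-class slot `zG(G)·(P.Klam·U)⁴` (coefficient an ENGINE-chosen `GeoConsts` datum) has per-scale size `≤ 1·unit`
(`U ≤ 1`) and window sum `≤ unit·c/ln 4 ≤ 1·unit` by `IsKLRegime U c (−n)` and `c ≤ cX := ln 4`.  Proof = `betaSplitP_of_edgeClausesFZ`'s over `pairArrayAtV17F_of_edgeClauses_explicitG`. -/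
theorem betaSplitP_of_edgeClausesFZG {Pr : Preds} {W : Set ℝ} {sG sQ tG tQ tN sF tF : ℝ} (hsG : 0 ≤ sG) (hsQ : 0 ≤ sQ) (htG : 0 ≤ tG)
    (htQ : 0 ≤ tQ) (htN : 0 ≤ tN) (hsF : 0 ≤ sF) (htF : 0 ≤ tF) (hκ : 12 * (tQ + sQ) + tQ ≤ klLegKappa)
    (zG : GeoConsts → ℝ) (hzG : ∀ G : GeoConsts, G.WF → 0 ≤ zG G) (uR : RenConsts → ℝ) (huR : ∀ R : RenConsts, R.WF → 0 < uR R)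
    (uX cX : GeoConsts → SplitConsts → EngConsts → ℝ)
    (huX : ∀ (G : GeoConsts) (P : SplitConsts) (Q : EngConsts), G.WF → P.WF → Q.WF → 0 < uX G P Q)
    (hcX : ∀ (G : GeoConsts) (P : SplitConsts) (Q : EngConsts), G.WF → P.WF → Q.WF → 0 < cX G P Q)
    (𝔛 : ∀ (L M : ℕ) [NeZero L] [NeZero M], GeoConsts → SplitConsts → EngConsts → ℝ → ℝ → ℝ → ℕ →
      TorusSite 2 L → TorusSite 2 L → TorusSite 2 L → ℝ)
    (h𝔛0 : ∀ (L M : ℕ) [NeZero L] [NeZero M] (G : GeoConsts) (P : SplitConsts) (Q : EngConsts) (β U μ : ℝ) (j : ℕ)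
      (Qm k k' : TorusSite 2 L), G.WF → P.WF → Q.WF → 0 ≤ 𝔛 L M G P Q β U μ j Qm k k')
    (h𝔛sup : ∀ (L M : ℕ) [NeZero L] [NeZero M] (G : GeoConsts) (P : SplitConsts) (Q : EngConsts) (β U μ : ℝ) (j : ℕ)
      (Qm k k' : TorusSite 2 L), G.WF → P.WF → Q.WF → 0 ≤ U → |U| ≤ 1 → U ≤ uX G P Q →
        𝔛 L M G P Q β U μ j Qm k k' ≤ sG * (G.CF * (P.Klam * U) ^ 2) + sQ * (Q.CR * P.Klam ^ 3 * U ^ 2) + sF * (zG G * P.Klam ^ 4 * U ^ 2))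
    (h𝔛sum : ∀ (L M : ℕ) [NeZero L] [NeZero M] (G : GeoConsts) (P : SplitConsts) (Q : EngConsts) (R : RenConsts) (β U μ : ℝ)
      (K : TrigPolyC4v) (t n : ℕ) (Qm k k' : TorusSite 2 L) (c : ℝ), G.WF → P.WF → Q.WF → R.WF → 0 ≤ U → |U| ≤ 1 → U ≤ uR R → U ≤ uX G P Q →
        0 < c → c ≤ cX G P Q → n ≤ nScales β → IsKLRegime U c (-(n : ℤ)) →
        HistP Pr L M G P Q R β U μ K n →
        ∑ j ∈ Ioc t n, 𝔛 L M G P Q β U μ j Qm k k' ≤ tG * (G.CF * (P.Klam * U) ^ 2) + tQ * (Q.CR * P.Klam ^ 3 * U ^ 2) + tF * (zG G * P.Klam ^ 4 * U ^ 2))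
    (h𝔛tot : ∀ (L M : ℕ) [NeZero L] [NeZero M] (G : GeoConsts) (P : SplitConsts) (Q : EngConsts) (R : RenConsts) (β U μ : ℝ)
      (K : TrigPolyC4v) (n : ℕ) (Qm k k' : TorusSite 2 L) (c : ℝ), G.WF → P.WF → Q.WF → R.WF → 0 ≤ U → |U| ≤ 1 → U ≤ uR R → U ≤ uX G P Q →
        0 < c → c ≤ cX G P Q → n ≤ nScales β → IsKLRegime U c (-(n : ℤ)) →
        HistP Pr L M G P Q R β U μ K n →
        𝔛 L M G P Q β U μ 0 Qm k k' + ∑ i ∈ range n, 𝔛 L M G P Q β U μ (i + 1) Qm k k' ≤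
          tG * (G.CF * (P.Klam * U) ^ 2) + tQ * (Q.CR * P.Klam ^ 3 * U ^ 2) + tF * (zG G * P.Klam ^ 4 * U ^ 2))
    (𝔑 : ∀ (L : ℕ), GeoConsts → SplitConsts → EngConsts → ℝ → ℝ → ℝ → ℕ → TorusSite 2 L → ℝ)
    (h𝔑sum : ∀ (L : ℕ) (G : GeoConsts) (P : SplitConsts) (Q : EngConsts) (β U μ : ℝ) (t : ℕ) (Qm : TorusSite 2 L),
      G.WF → P.WF → Q.WF → 0 ≤ U → |U| ≤ 1 → t ≤ nScales β → IsPairClassAt L Qm t →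
        ∑ i ∈ range t, 𝔑 L G P Q β U μ (i + 1) Qm ≤ tN * (G.bhi + 1))
    (hs : ∀ (L M : ℕ) [NeZero L] [NeZero M] (G : GeoConsts) (P : SplitConsts) (Q : EngConsts) (β U μ : ℝ) (K : TrigPolyC4v) (n : ℕ),
      BetaSplitAtV17F L M G P Q β U μ n → Pr.split L M G P Q β U μ K n)
    (he : ∀ (L M : ℕ) [NeZero L] [NeZero M] (G : GeoConsts) (P : SplitConsts) (Q : EngConsts) (β U μ : ℝ) (K : TrigPolyC4v) (n : ℕ),
      Pr.engine L M G P Q β U μ K n →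
        (n = 0 → ∀ Qm : TorusSite 2 L, ∀ k ∈ klBall L μ 0, ∀ k' ∈ klBall L μ 0,
          ‖klPairAmplitude L M β U μ (klFlowFrameU L M β U μ 0) 0 Qm k k' - (U : ℂ)‖ ≤ initDevBar G U + 𝔛 L M G P Q β U μ 0 Qm k k') ∧
        (1 ≤ n → ∀ Qm : TorusSite 2 L, IsPairClassAt L Qm n →
          ∃ w : TorusSite 2 L → ℝ, (∑ p, |w p| ≤ G.bhi) ∧ (∑ p, (|w p| - w p) ≤ 𝔑 L G P Q β U μ n Qm) ∧
            ∃ N : Matrix (TorusSite 2 L) (TorusSite 2 L) ℂ,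
              (1 + Matrix.diagonal (fun p => (w p : ℂ)) * klPairArrayF L M β U μ (n - 1) Qm) * N = 1 ∧
              ∀ k ∈ klBall L μ 0, ∀ k' ∈ klBall L μ 0,
                ‖klPairAmplitude L M β U μ (klFlowFrameU L M β U μ n) n Qm k k' - (klPairArrayF L M β U μ (n - 1) Qm * N) k k'‖ ≤
                  drivePBar G P U (n - 1) + eremBar G P Q U β L (n - 1) + 𝔛 L M G P Q β U μ n Qm k k') ∧
        (1 ≤ n → ∀ Qm : TorusSite 2 L, ∀ k ∈ klBall L μ 0, ∀ k' ∈ klBall L μ 0,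
          ‖klPairAmplitude L M β U μ (klFlowFrameU L M β U μ n) n Qm k k' - klPairAmplitude L M β U μ (klFlowFrameU L M β U μ (n - 1)) (n - 1) Qm k k'‖ ≤
            gainBar G P U n (klTorusNorm L Qm) (klTorusNorm L (k - k')) (klTorusNorm L (k + k' - Qm)) +
              eremBar G P Q U β L (n - 1) + 𝔛 L M G P Q β U μ n Qm k k') ∧
        EngineFirstMoments L M G P Q β U μ (klFlowFrameU L M β U μ n) n ∧ IsoTupleL1AtV17F L M G P β U μ n) :
    BetaSplitP Pr W := by
  intro G hG
  -- nonnegativity of the `G`-constants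
  have hCF : 0 ≤ G.CF := hG.2.2.2.2.2.2.2.2.2.2.2.2.2.1
  have hcloc : 0 ≤ G.cloc := hG.2.2.2.2.1
  have haplus : 0 ≤ G.aplus := hG.2.2.2.2.2.2.2.2.2.2.1
  have hθ : 0 < G.θ := hG.2.2.2.2.2.1
  have hbhi : 0 ≤ G.bhi := le_trans hG.2.2.1 hG.2.2.2.1
  have hcE4 : 0 ≤ G.cE4 := hG.2.2.2.2.2.2.2.2.2.2.2.2.2.2.2.2.1
  have hZ : 0 ≤ G.Z := le_trans (sum_nonneg fun j _ => hG.2.2.2.2.2.2.2.2.1 j) (hG.2.2.2.2.2.2.2.2.2.1 0)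
  have hab : 0 ≤ ∑ χ : D4Irrep, (G.abot χ + G.atop χ) := sum_nonneg fun χ _ => add_nonneg (hG.2.1 χ) (hG.1 χ)
  have hg : 0 ≤ (1 - (4 : ℝ) ^ (-G.θ))⁻¹ :=
    inv_nonneg.2 (by have := Real.rpow_lt_one_of_one_lt_of_neg (x := (4 : ℝ)) (by norm_num) (by linarith : -G.θ < 0); linarith)
  -- the induction constants `P` (kept opaque)
  obtain ⟨Klam, hKlam⟩ : ∃ x : ℝ, x = 2 * G.CF + 3 := ⟨_, rfl⟩
  have hKlam1 : 1 ≤ Klam := by rw [hKlam]; linarith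
  have hKlam0 : 0 ≤ Klam := zero_le_one.trans hKlam1
  have hK2 : 0 ≤ Klam ^ 2 := sq_nonneg _
  have hx1 : 0 ≤ G.aplus * Klam ^ 2 * G.Z := mul_nonneg (mul_nonneg haplus hK2) hZ
  have hx2 : 0 ≤ G.cloc * Klam ^ 2 * (1 - (4 : ℝ) ^ (-G.θ))⁻¹ := mul_nonneg (mul_nonneg hcloc hK2) hg
  have hnum : 0 ≤ 12 * (tG + sG) + 3 + tG := by positivity
  have hzG0 : 0 ≤ zG G := hzG G hG
  have hK4 : 0 ≤ zG G * Klam ^ 4 := mul_nonneg hzG0 (pow_nonneg hKlam0 4)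
  have hnumF : 0 ≤ 12 * (tF + sF) + tF := by positivity
  obtain ⟨CW, hCW⟩ : ∃ x : ℝ, x = 12 * (∑ χ : D4Irrep, (G.abot χ + G.atop χ) + 1) +
      25 * (G.aplus * Klam ^ 2 * G.Z + G.cloc * Klam ^ 2 * (1 - (4 : ℝ) ^ (-G.θ))⁻¹ + 1) + 2 +
        (12 * (tG + sG) + 3 + tG) * (G.CF * Klam ^ 2) + (12 * (tF + sF) + tF) * (zG G * Klam ^ 4) := ⟨_, rfl⟩
  have hCW0 : 0 ≤ CW := by rw [hCW]; positivity
  refine ⟨⟨Klam, CW, G.cE4 + 1, 0⟩, ⟨hKlam1, hCW0, by positivity⟩, ?_⟩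
  intro Q hQ
  have hPWF : (⟨Klam, CW, G.cE4 + 1, 0⟩ : SplitConsts).WF := ⟨hKlam1, hCW0, by positivity⟩
  have hCR : 0 ≤ Q.CR := hQ.2.1
  have hQcE4 : 0 ≤ Q.cE4 := hQ.2.2.2.1
  have hCL : ∀ β n, 0 ≤ Q.CL β n := hQ.2.2.2.2.2.2.2
  -- the no-onset constant `c₀` (after `Q`: it reads `Q.CR`)
  obtain ⟨Crow, hCrow_def⟩ : ∃ x : ℝ, x = (∑ χ : D4Irrep, (G.abot χ + G.atop χ) + 1) +
      2 * (G.aplus * Klam ^ 2 * G.Z + G.cloc * Klam ^ 2 * (1 - (4 : ℝ) ^ (-G.θ))⁻¹ + 1) + 1 + (tG + sG) * (G.CF * Klam ^ 2) +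
        (tQ + sQ) * (Q.CR * Klam ^ 3) + (tF + sF) * (zG G * Klam ^ 4) := ⟨_, rfl⟩
  have hK3 : 0 ≤ Q.CR * Klam ^ 3 := by positivity
  have hCrow1 : 1 ≤ Crow := by
    rw [hCrow_def]; nlinarith [mul_nonneg hCF hK2, mul_nonneg (add_nonneg htG hsG) (mul_nonneg hCF hK2),
      mul_nonneg (add_nonneg htQ hsQ) hK3, mul_nonneg (add_nonneg htF hsF) hK4]
  have hCrow : 0 ≤ Crow := zero_le_one.trans hCrow1
  have hlog4 : 0 < Real.log 4 := Real.log_pos (by norm_num)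
  -- the no-onset constant reads `8·42 = 336 = 160·(21/10)`
  obtain ⟨Crow', hCrow'_def⟩ : ∃ x : ℝ, x = 21 / 10 * Crow := ⟨_, rfl⟩
  have hCrow'pos : 0 < Crow' := by rw [hCrow'_def]; positivity
  have hCrow' : 0 ≤ Crow' := hCrow'pos.le
  have hcXpos : 0 < cX G (⟨Klam, CW, G.cE4 + 1, 0⟩ : SplitConsts) Q := hcX G _ Q hG hPWF hQ
  refine ⟨min (Real.log 4 / (160 * Crow' * (G.bhi + 1))) (cX G (⟨Klam, CW, G.cE4 + 1, 0⟩ : SplitConsts) Q), lt_min (by positivity) hcXpos, ?_⟩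
  intro c hc hcmin R hR
  have hcc₀ : c ≤ Real.log 4 / (160 * Crow' * (G.bhi + 1)) := hcmin.trans (min_le_left _ _)
  have hccX : c ≤ cX G (⟨Klam, CW, G.cE4 + 1, 0⟩ : SplitConsts) Q := hcmin.trans (min_le_right _ _)
  -- `U₀`
  obtain ⟨CW', hCW'_def⟩ : ∃ x : ℝ, x = CW + klLegKappa * Q.CR * Klam ^ 3 := ⟨_, rfl⟩
  have hκ0 : 0 ≤ klLegKappa := by unfold klLegKappa; norm_num
  have hCW'0 : 0 ≤ CW' := by
    rw [hCW'_def]; exact add_nonneg hCW0 (mul_nonneg (mul_nonneg hκ0 hCR) (pow_nonneg hKlam0 3))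
  obtain ⟨Dval, hDval_def⟩ : ∃ x : ℝ, x = CW' + G.CF * CW' + G.CF * Klam ^ 2 := ⟨_, rfl⟩
  have hDval : 0 ≤ Dval := by
    rw [hDval_def]; exact add_nonneg (add_nonneg hCW'0 (mul_nonneg hCF hCW'0)) (mul_nonneg hCF hK2)
  obtain ⟨U₀, hU₀_def⟩ : ∃ x : ℝ, x = min 1 (min (1 / (2 * Q.CR * Klam ^ 3 + 1)) (min (1 / (Q.cE4 + 1)) (min (1 / (Dval + 1))
      (min (1 / (16 * tN * (G.bhi + 1) + 1)) (min (uR R) (uX G (⟨Klam, CW, G.cE4 + 1, 0⟩ : SplitConsts) Q)))))) := ⟨_, rfl⟩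
  have huXpos : 0 < uX G (⟨Klam, CW, G.cE4 + 1, 0⟩ : SplitConsts) Q := huX G _ Q hG hPWF hQ
  have htNb : 0 ≤ 16 * tN * (G.bhi + 1) := by positivity
  have hU₀ : 0 < U₀ := by
    rw [hU₀_def]
    exact lt_min one_pos (lt_min (by positivity) (lt_min (by positivity) (lt_min (by positivity) (lt_min (by positivity)
      (lt_min (huR R hR) huXpos)))))
  refine ⟨U₀, hU₀, fun β U => ⌈17 * (∑ j ∈ range (nScales β + 1), Q.CL β j) / U ^ 2⌉₊, fun _ _ _ => 0, ?_⟩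
  intro μ hμ U hU hUle β hβmin hβc K hK L M _ _ hL hM n hn hKL hHist hE hT
  -- the smallness lines out of `U ≤ U₀`
  rw [hU₀_def] at hUle
  have hU1 : U ≤ 1 := hUle.trans (min_le_left _ _)
  have hUa : |U| = U := abs_of_pos hU
  have hUa1 : |U| ≤ 1 := by rw [hUa]; exact hU1
  have hUCR : 2 * Q.CR * Klam ^ 3 * |U| ≤ 1 := by
    rw [hUa]
    exact klbs_mul_le_one_of_le_inv (by positivity) hU.le (hUle.trans ((min_le_right _ _).trans (min_le_left _ _)))
  have hUcE4 : Q.cE4 * |U| ≤ 1 := by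
    rw [hUa]
    exact klbs_mul_le_one_of_le_inv hQcE4 hU.le
      (hUle.trans ((min_le_right _ _).trans ((min_le_right _ _).trans (min_le_left _ _))))
  have hUD : Dval * U ≤ 1 :=
    klbs_mul_le_one_of_le_inv hDval hU.le
      (hUle.trans ((min_le_right _ _).trans ((min_le_right _ _).trans ((min_le_right _ _).trans (min_le_left _ _)))))
  have hUN : 16 * tN * (G.bhi + 1) * U ≤ 1 :=
    klbs_mul_le_one_of_le_inv htNb hU.le
      (hUle.trans ((min_le_right _ _).trans ((min_le_right _ _).trans ((min_le_right _ _).trans ((min_le_right _ _).trans (min_le_left _ _))))))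
  have hURX : U ≤ min (uR R) (uX G (⟨Klam, CW, G.cE4 + 1, 0⟩ : SplitConsts) Q) :=
    hUle.trans ((min_le_right _ _).trans ((min_le_right _ _).trans ((min_le_right _ _).trans ((min_le_right _ _).trans (min_le_right _ _)))))
  have hUR : U ≤ uR R := hURX.trans (min_le_left _ _)
  have hUX : U ≤ uX G (⟨Klam, CW, G.cE4 + 1, 0⟩ : SplitConsts) Q := hURX.trans (min_le_right _ _)
  have hc' : 160 * Crow' * (G.bhi + 1) * c ≤ Real.log 4 := by
    have hpos : 0 < 160 * Crow' * (G.bhi + 1) := by positivity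
    have := (le_div_iff₀ hpos).1 hcc₀
    linarith
  -- the engine clauses at every scale `j ≤ n` (history + the scale-`n` hypothesis)
  have hEn := he L M G (⟨Klam, CW, G.cE4 + 1, 0⟩ : SplitConsts) Q β U μ K n hE
  have hEall : ∀ j ≤ n,
      (j = 0 → ∀ Qm : TorusSite 2 L, ∀ k ∈ klBall L μ 0, ∀ k' ∈ klBall L μ 0,
          ‖klPairAmplitude L M β U μ (klFlowFrameU L M β U μ 0) 0 Qm k k' - (U : ℂ)‖ ≤
            initDevBar G U + 𝔛 L M G (⟨Klam, CW, G.cE4 + 1, 0⟩ : SplitConsts) Q β U μ 0 Qm k k') ∧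
        (1 ≤ j → ∀ Qm : TorusSite 2 L, IsPairClassAt L Qm j →
          ∃ w : TorusSite 2 L → ℝ, (∑ p, |w p| ≤ G.bhi) ∧
            (∑ p, (|w p| - w p) ≤ 𝔑 L G (⟨Klam, CW, G.cE4 + 1, 0⟩ : SplitConsts) Q β U μ j Qm) ∧
            ∃ N : Matrix (TorusSite 2 L) (TorusSite 2 L) ℂ,
              (1 + Matrix.diagonal (fun p => (w p : ℂ)) * klPairArrayF L M β U μ (j - 1) Qm) * N = 1 ∧
              ∀ k ∈ klBall L μ 0, ∀ k' ∈ klBall L μ 0,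
                ‖klPairAmplitude L M β U μ (klFlowFrameU L M β U μ j) j Qm k k' - (klPairArrayF L M β U μ (j - 1) Qm * N) k k'‖ ≤
                  drivePBar G (⟨Klam, CW, G.cE4 + 1, 0⟩ : SplitConsts) U (j - 1) + eremBar G (⟨Klam, CW, G.cE4 + 1, 0⟩ : SplitConsts) Q U β L (j - 1) + 𝔛 L M G (⟨Klam, CW, G.cE4 + 1, 0⟩ : SplitConsts) Q β U μ j Qm k k') ∧
        (1 ≤ j → ∀ Qm : TorusSite 2 L, ∀ k ∈ klBall L μ 0, ∀ k' ∈ klBall L μ 0,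
          ‖klPairAmplitude L M β U μ (klFlowFrameU L M β U μ j) j Qm k k' - klPairAmplitude L M β U μ (klFlowFrameU L M β U μ (j - 1)) (j - 1) Qm k k'‖ ≤
            gainBar G (⟨Klam, CW, G.cE4 + 1, 0⟩ : SplitConsts) U j (klTorusNorm L Qm) (klTorusNorm L (k - k')) (klTorusNorm L (k + k' - Qm)) +
              eremBar G (⟨Klam, CW, G.cE4 + 1, 0⟩ : SplitConsts) Q U β L (j - 1) + 𝔛 L M G (⟨Klam, CW, G.cE4 + 1, 0⟩ : SplitConsts) Q β U μ j Qm k k') := by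
    intro j hj
    rcases Nat.lt_or_ge j n with hlt | hge
    · have h := he L M G (⟨Klam, CW, G.cE4 + 1, 0⟩ : SplitConsts) Q β U μ K j (hHist j hlt).2.2.1
      exact ⟨h.1, h.2.1, h.2.2.1⟩
    · have : j = n := le_antisymm hj hge
      subst this
      exact ⟨hEn.1, hEn.2.1, hEn.2.2.1⟩
  -- (B1-v2′) from the generic row 0′, in the regime
  have hLline : 17 * ∑ j ∈ range n, Q.CL β j / L ≤ U ^ 2 := klbs_volume_line hCL hU hn hL
  have hsmall : 8 * 42 * (((∑ χ : D4Irrep, (G.abot χ + G.atop χ) + 1) +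
      2 * (G.aplus * Klam ^ 2 * G.Z + G.cloc * Klam ^ 2 * (1 - (4 : ℝ) ^ (-G.θ))⁻¹ + 1) + 1 + (tG + sG) * (G.CF * Klam ^ 2) +
        (tQ + sQ) * (Q.CR * Klam ^ 3) + (tF + sF) * (zG G * Klam ^ 4)) * U ^ 2) * (G.bhi * n) ≤ 1 := by
    rw [← hCrow_def]
    have h := klbs_noOnset_line hCrow' hbhi hKL hc'
    rw [hCrow'_def] at h
    linarith
  -- the negative-mass line at every pair-class scale `t ≤ n`
  have hnegline : ∀ Qm : TorusSite 2 L, ∀ t ≤ n, IsPairClassAt L Qm t →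
      16 * U * ∑ i ∈ range t, 𝔑 L G (⟨Klam, CW, G.cE4 + 1, 0⟩ : SplitConsts) Q β U μ (i + 1) Qm ≤ 1 := by
    intro Qm t htn hQt
    have h1 := h𝔑sum L G (⟨Klam, CW, G.cE4 + 1, 0⟩ : SplitConsts) Q β U μ t Qm hG hPWF hQ hU.le hUa1 (htn.trans hn) hQt
    have h2 : 16 * U * ∑ i ∈ range t, 𝔑 L G (⟨Klam, CW, G.cE4 + 1, 0⟩ : SplitConsts) Q β U μ (i + 1) Qm ≤ 16 * U * (tN * (G.bhi + 1)) :=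
      mul_le_mul_of_nonneg_left h1 (by positivity)
    refine h2.trans ?_
    have : 16 * U * (tN * (G.bhi + 1)) = 16 * tN * (G.bhi + 1) * U := by ring
    rw [this]; exact hUN
  have hB1 : PairArrayAtV17F L M (⟨Klam, CW, G.cE4 + 1, 0⟩ : SplitConsts) Q β U μ n :=
    pairArrayAtV17F_of_edgeClauses_explicitG L M hG hPWF hQ hU.le hsG hsQ htG htQ hsF htF hzG0 hκ
      (fun j Qm k k' => 𝔛 L M G (⟨Klam, CW, G.cE4 + 1, 0⟩ : SplitConsts) Q β U μ j Qm k k')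
      (fun j Qm k k' => h𝔛0 L M G (⟨Klam, CW, G.cE4 + 1, 0⟩ : SplitConsts) Q β U μ j Qm k k' hG hPWF hQ)
      (fun j Qm k k' => h𝔛sup L M G (⟨Klam, CW, G.cE4 + 1, 0⟩ : SplitConsts) Q β U μ j Qm k k' hG hPWF hQ hU.le hUa1 hUX)
      (fun t Qm k k' => h𝔛sum L M G (⟨Klam, CW, G.cE4 + 1, 0⟩ : SplitConsts) Q R β U μ K t n Qm k k' c hG hPWF hQ hR hU.le hUa1 hUR hUX
        hc hccX hn hKL hHist)
      (fun Qm k k' => h𝔛tot L M G (⟨Klam, CW, G.cE4 + 1, 0⟩ : SplitConsts) Q R β U μ K n Qm k k' c hG hPWF hQ hR hU.le hUa1 hUR hUX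
        hc hccX hn hKL hHist)
      (fun j Qm => 𝔑 L G (⟨Klam, CW, G.cE4 + 1, 0⟩ : SplitConsts) Q β U μ j Qm) hnegline
      ((hEall 0 (Nat.zero_le n)).1 rfl)
      (fun j hj1 hjn => (hEall j hjn).2.1 hj1) (fun j hj1 hjn => (hEall j hjn).2.2 hj1)
      hUCR hLline hsmall (by rw [hCW])
  -- the per-scale step: value line, iso endpoint line, first moments
  have hUD' : (CW' + G.CF * CW' + G.CF * Klam ^ 2) * U ≤ 1 := by rwa [hDval_def] at hUD
  obtain ⟨hKval, harith⟩ := klbs_value_consts hCF hCW'0 hKlam hU.le hUD'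
  have hB : BetaSplitAtV17F L M G (⟨Klam, CW, G.cE4 + 1, 0⟩ : SplitConsts) Q β U μ n := by
    have hB0 : 0 ≤ 2 * |U| + (CW + klLegKappa * Q.CR * Klam ^ 3) * U ^ 2 := by
      rw [← hCW'_def]; exact add_nonneg (mul_nonneg zero_le_two (abs_nonneg U)) (mul_nonneg hCW'0 (sq_nonneg U))
    refine betaSplitAtV17F_of_pairArrayAtV17F L M (⟨Klam, CW, G.cE4 + 1, 0⟩ : SplitConsts) Q hB0 hKlam0 hB1 hEn.2.2.2.2 hEn.2.2.2.1 ?_ ?_ ?_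
    · show G.CF * (2 * |U| + (CW + klLegKappa * Q.CR * Klam ^ 3) * U ^ 2) + G.CF * (Klam * U) ^ 2 ≤ Klam * |U|
      rw [hUa, ← hCW'_def]; exact harith
    · show 2 * |U| + (CW + klLegKappa * Q.CR * Klam ^ 3) * U ^ 2 ≤ Klam * |U|
      rw [hUa, ← hCW'_def]; exact hKval
    · show G.cE4 + Q.cE4 * |U| ≤ G.cE4 + 1
      linarith
  exact hs L M G _ Q β U μ K n hB

end Summit.HubbardSuperconductivity.HubbardSuperconductivity.Theorems.KLRegimeSplit

end
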